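/-
Copyright (c) 2026 the pub-hodgecm-mathlib formalisation cell (harness21).  Prover seat hodgecm-mathlib-A-p17 (g20), floor 0, programme P5
(Alb-CM), in-house road for the letter L4if (ROAD CARD v4 §2 (iv), A-p18 (g24)), the closer's glue (P1).  KERNEL module: THEOREMS ONLY
(no definition, no named fact, no `sorry`, no instance, no notation).
-/
import Literature.NumberTheory.Automorphic.Liu2021.LemD1LocalInjectivity
import Literature.NumberTheory.Automorphic.UnitaryGroupLocalCenterScalar
import HarnessLib

/-!
# F0 · P5, letter L4if, link (iv) — GLUE: two twisted transports with cancelling multipliers give «isomorphic» (`AreIsomorphicRep`)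

Cell `hodgecm-mathlib`, floor 0, programme P5 (Alb-CM); crux item `stmt-HodgeConjecture-24832`
(`Summit.HodgeConjecture.HodgeConjecture.Theses.HCCMUnconditional.HLiu418`).  Road card `F0/P5/A-p18/g24/ROAD-L4if-v4.A-p18g24.md` §2 (iv):
the core link `Θ(Λ′, −a₀) ≅ Θ(Λ, a)` is the composite of ★ step 3 (`exists_coinv_equiv_companion_galConj`: `T ∘ Θ_{Λ′}(k) = c₁(k) • Θ_{Λᶜ}(k) ∘ T`,
`c₁(k) = α₀((det k)_v)`) and (C4bΘ) (`E ∘ Θ_{Λᶜ}(k) = c₂(k) • Θ_Λ(k) ∘ E`, `c₂(k) = ξ(localUnitScalar (det k)⁻¹)`), whose multipliers cancel by ★ §6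
`apply_finitePart_adelicDet_inclPlace_mul_localCharOfCenter_inv`.  This file is the 10-line algebra of that composition, stated for ARBITRARY
representations (pure linear algebra; default heartbeats):

* `areIsomorphicRep_of_twisted_transports`: `∃ T, T (ρ_A k x) = c₁ k • ρ_B k (T x)` and `∃ E, E (ρ_B k y) = c₂ k • ρ_C k (E y)` with `c₁ k * c₂ k = 1`
  for all `k` ⟹ `AreIsomorphicRep ρ_A ρ_C` (witness `E ∘ T`); and the one-transport case `areIsomorphicRep_of_twisted_transport_of_eq_one`;
* `localUnitScalar_congr`: `localUnitScalar z h = localUnitScalar z′ h′` from `z = z′` (the proof argument is irrelevant) — to match (C4bΘ)'s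
  `det (localPiEquiv (k ⊗ 1))` with ★ (D8) `det_localPiEquiv_localLineInl`'s `det (localPiEquiv k)` inside the multiplier.

HONEST LABEL: HC_CM is proved only modulo the printed citations — the 2 remaining named inputs (hLiu418, h413) — until rung 0 closes; this
file proves helper lemmas toward ONE registered letter stub (L4if) of ONE floor-0 pay-down line and discharges no letter by itself.

## References
* [Liu2021] Y. Liu, *Fourier–Jacobi cycles and arithmetic relative trace formula*, Camb. J. Math. 9 (2021) = arXiv:2102.11518: App. D §D.1
  Step 3 (l. 5221), Lem. D.1 (4) (p. 126, l. 5235).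
* [GelbartRogawski1991] S. Gelbart, J. Rogawski, Invent. Math. 105 (1991), §3.1 Remark p. 457 L4–13.
* [Mok2014] C. P. Mok, Mem. AMS 235 (2015), §1 Notation p. 5.
-/

set_option autoImplicit false
set_option linter.dupNamespace false

noncomputable section

open NumberField IsDedekindDomain
open Literature.NumberTheory.Automorphic Literature.NumberTheory.Automorphic.UnitaryGroup
open Literature.NumberTheory.Automorphic.Liu2021

namespace Summit.HodgeConjecture.HodgeConjecture.Cruxes.HLiu418.F0P5LemD14IfTwistedTransportGlue

/-! ## §1 Two twisted transports with cancelling multipliers -/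

section Algebra

variable {G : Type*} [Group G] {A B C : Type*} [AddCommGroup A] [Module ℂ A] [AddCommGroup B] [Module ℂ B] [AddCommGroup C] [Module ℂ C]

/-- **Two twisted transports with cancelling multipliers compose to an honest intertwiner**: `AreIsomorphicRep ρ_A ρ_C`, witness `E ∘ T`.
[cite: GelbartRogawski1991, §3.1 Remark p. 457 L4–13] [cite: Liu2021, App. D §D.1 Step 3 (l. 5221), Lemma D.1 (4) (l. 5235)] -/
theorem areIsomorphicRep_of_twisted_transports (ρA : Representation ℂ G A) (ρB : Representation ℂ G B) (ρC : Representation ℂ G C)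
    (c₁ c₂ : G → ℂ) (hT : ∃ T : A ≃ₗ[ℂ] B, ∀ (g : G) (x : A), T (ρA g x) = c₁ g • ρB g (T x))
    (hE : ∃ E : B ≃ₗ[ℂ] C, ∀ (g : G) (y : B), E (ρB g y) = c₂ g • ρC g (E y)) (hc : ∀ g, c₁ g * c₂ g = 1) :
    AreIsomorphicRep ρA ρC := by
  obtain ⟨T, hT⟩ := hT
  obtain ⟨E, hE⟩ := hE
  refine ⟨T.trans E, fun g x => ?_⟩
  rw [LinearEquiv.trans_apply, LinearEquiv.trans_apply, hT, map_smul, hE, smul_smul, hc, one_smul]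

/-- the one-transport case: a `c`-twisted intertwiner with `c ≡ 1` is an honest one. [cite: Liu2021, App. D Lemma D.1 (4) (l. 5235)] -/
theorem areIsomorphicRep_of_twisted_transport_of_eq_one (ρA : Representation ℂ G A) (ρB : Representation ℂ G B) (c : G → ℂ)
    (hT : ∃ T : A ≃ₗ[ℂ] B, ∀ (g : G) (x : A), T (ρA g x) = c g • ρB g (T x)) (hc : ∀ g, c g = 1) : AreIsomorphicRep ρA ρB := by
  obtain ⟨T, hT⟩ := hT
  refine ⟨T, fun g x => ?_⟩
  rw [hT, hc, one_smul]

/-- symmetric bookkeeping: the inverse of a `c`-twisted transport is a `c⁻¹`-twisted transport (for unit-valued `c`).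
[cite: GelbartRogawski1991, §3.1 Remark p. 457 L4–13] -/
theorem exists_twisted_transport_symm (ρA : Representation ℂ G A) (ρB : Representation ℂ G B) (c : G → ℂˣ)
    (hT : ∃ T : A ≃ₗ[ℂ] B, ∀ (g : G) (x : A), T (ρA g x) = ((c g : ℂˣ) : ℂ) • ρB g (T x)) :
    ∃ T' : B ≃ₗ[ℂ] A, ∀ (g : G) (y : B), T' (ρB g y) = (((c g)⁻¹ : ℂˣ) : ℂ) • ρA g (T' y) := by
  obtain ⟨T, hT⟩ := hT
  refine ⟨T.symm, fun g y => ?_⟩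
  apply T.injective
  rw [LinearEquiv.apply_symm_apply, map_smul, hT, LinearEquiv.apply_symm_apply, smul_smul, Units.inv_mul, one_smul]

end Algebra

/-! ## §2 `localUnitScalar` does not depend on the norm-one proof -/

section Scalar

variable {F : Type} (E : Type) [Field F] [NumberField F] [Field E] [NumberField E] [Algebra F E] (c : E ≃ₐ[F] E)
  (J₁ : Matrix (Fin 1) (Fin 1) E) (v : HeightOneSpectrum (𝓞 F))

/-- **`localUnitScalar z h = localUnitScalar z′ h′` from `z = z′`** (proof irrelevance of the norm-one hypothesis). [cite: Mok2014, §1 Notation p. 5] -/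
theorem localUnitScalar_congr {z z' : (LocalRing E v)ˣ} (h : z = z') (hz : (z : LocalRing E v) * conjLocal E c v z = 1)
    (hz' : (z' : LocalRing E v) * conjLocal E c v z' = 1) :
    localUnitScalar E c J₁ v z hz = localUnitScalar E c J₁ v z' hz' := by
  subst h
  rfl

end Scalar

end Summit.HodgeConjecture.HodgeConjecture.Cruxes.HLiu418.F0P5LemD14IfTwistedTransportGlue

end
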